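import Literature.Computability.Complexity.Rossman2008CliqueProofs
import Literature.Computability.Complexity.RossmanMonotoneClique
import HarnessLib

/-!
# Unions of independent binomial random graphs ("sprinkling") in the finite-sum model of `G(n,p)`

Tools for the proof of Theorem 2 of

* B. Rossman, *The monotone complexity of k-clique on random graphs*, FOCS 2010 / SIAM J. Comput.
  43 (2014) [Rossman2010], §7 and Appendix B (proof of Lemma 17, p. 14 of the full version),

over the finite-sum vocabulary of `Rossman2008.lean` / `RossmanMonotoneClique.lean`
(`gnpWeight n p x = p^{e(x)} (1-p)^{C(n,2)-e(x)}`, `gnpProb`, `cliqueCount = ω_k`, edge vectors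
`x : E(K_n) → Bool`, union of graphs = the lattice join `x ⊔ y`, i.e. edgewise `or`).
Everything here is PROVED; there are no definitions and no named facts.

* `sum_sum_gnpWeight_mul_sup` — the **union law**: for independent `G₁ ∼ G(n,p)`, `G₂ ∼ G(n,q)`,
  `G₁ ∪ G₂ ∼ G(n, p + q - pq)` ("`G^θ ∪ G⁻` has distribution `G(n, p^θ + p⁻ - p^θ p⁻)`", App. B),
  as the identity `Σ_x Σ_y w_p(x) w_q(y) F(x ∨ y) = Σ_z w_{p+q-pq}(z) F(z)`.
* `sum_filter_forall_gnpWeight_mul` — the **planting identity** (independence of disjoint edge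
  sets): `Σ_{x ⊇ t} w_q(x) G(x) = q^{e(t)} Σ_x w_q(x) G(x ∨ t)`.
* `sum_filter_cliqueVec_gnpWeight` — `Pr[K_A ⊆ G(n,q)] = q^{C(|A|,2)}`.
* `sum_sum_gnpWeight_newClique_le` — the first-moment **sprinkling bound**
  `Pr[ω_k(G₁ ∪ G₂) ≥ 1 ∧ ω_k(G₁) = 0] ≤ C(n,k) ((p+q-pq)^{C(k,2)} - p^{C(k,2)})` (this replaces the
  appeal to "the well-known asymptotics of `E[ω_k(G(n,p))]`" in the proof of Lemma 17).
* `sum_cliqueFree_gnpWeight_mul_gnpProb_sup_le`, `gnpProb_pos_cliqueFree_le_sprinkle`,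
  `gnpProb_pos_cliqueFree_mono` — consequences for a monotone test `f`: the probability of the
  "false positive" event `{f = 1 ∧ ω_k = 0}` can only grow by `C(n,k)(p'^{C(k,2)} - p^{C(k,2)})`
  when the edge density is raised from `p` to `p'`, and sprinkling a second graph onto a
  `k`-clique-free `G(n,p)` is controlled by the same quantity.

## References

* [Rossman2010] B. Rossman, The monotone complexity of k-clique on random graphs, FOCS 2010,
  193–201; SIAM J. Comput. 43 (2014) 256–279 — §7 and Appendix B.
-/

noncomputable section

namespace Literature.Computability.Complexity

open Finset

variable {n : ℕ}

/-! ### Joins of Boolean vectors -/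

/-- Pointwise, the join of two Boolean vectors is the coordinatewise `or` (the union of the two
graphs). [folklore] -/
theorem sup_apply_bool {ι : Type*} (x y : ι → Bool) (e : ι) : (x ⊔ y) e = (x e || y e) := by
  rw [Pi.sup_apply]
  exact congrFun (congrFun Bool.sup_eq_bor (x e)) (y e)

/-- Pointwise, the meet of two Boolean vectors is the coordinatewise `and` (the intersection of
the two graphs). [folklore] -/
theorem inf_apply_bool {ι : Type*} (x y : ι → Bool) (e : ι) : (x ⊓ y) e = (x e && y e) := by
  rw [Pi.inf_apply]
  exact congrFun (congrFun Bool.inf_eq_band (x e)) (y e)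

/-- Planting a clique is the join with the clique vector: `G ∪ K_A = G ∨ K_A`. [folklore] -/
theorem plantClique_eq_sup (A : Finset (Fin n)) (x : (⊤ : SimpleGraph (Fin n)).edgeSet → Bool) :
    plantClique A x = x ⊔ cliqueVec A := by
  funext e
  rw [sup_apply_bool, plantClique]

/-- A clique contained in `x` is contained in `x ∨ y`. [folklore] -/
theorem forall_cliqueVec_sup_of_left (A : Finset (Fin n))
    (x y : (⊤ : SimpleGraph (Fin n)).edgeSet → Bool) (h : ∀ e, cliqueVec A e = true → x e = true) :
    ∀ e, cliqueVec A e = true → (x ⊔ y) e = true := fun e he => by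
  rw [sup_apply_bool, h e he, Bool.true_or]

/-- `ω_k(z) = 0` iff no `k`-set spans a clique of `z` (unfolding of `cliqueCount`, independent of
the decidability instances). [folklore] -/
theorem cliqueCount_eq_zero_iff_forall {k : ℕ} (z : (⊤ : SimpleGraph (Fin n)).edgeSet → Bool) :
    cliqueCount n k z = 0 ↔
      ∀ A ∈ powersetCard k (univ : Finset (Fin n)), ¬ (∀ e, cliqueVec A e = true → z e = true) := by
  rw [cliqueCount, card_eq_zero, filter_eq_empty_iff]

/-! ### The union law -/

/-- The one-edge weights of `G(n,p)` and `G(n,q)` summed over the fibre of the coordinatewise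
`or`: `Σ_{(a,b) : a ∨ b = c} φ_p(a) φ_q(b) = φ_{p+q-pq}(c)`. [folklore] -/
theorem sum_filter_or_eq_oneEdge (p q : ℝ) (c : Bool) :
    ∑ ab ∈ (univ : Finset (Bool × Bool)).filter (fun ab => (ab.1 || ab.2) = c),
        (if ab.1 = true then p else 1 - p) * (if ab.2 = true then q else 1 - q) =
      if c = true then p + q - p * q else 1 - (p + q - p * q) := by
  rw [sum_filter, Fintype.sum_prod_type]
  simp only [Fintype.sum_bool]
  cases c <;> simp <;> ring

/-- **Union law** for independent binomial random graphs: if `G₁ ∼ G(n,p)` and `G₂ ∼ G(n,q)` are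
independent then `G₁ ∪ G₂ ∼ G(n, p + q - pq)`; as finite sums,
`Σ_x Σ_y w_p(x) w_q(y) F(x ∨ y) = Σ_z w_{p+q-pq}(z) F(z)` for every real-valued `F`
(Rossman 2010, Appendix B, proof of Lemma 17: "`G^θ ∪ G⁻` has distribution
`G(n, p^θ + p⁻ - p^θ p⁻)`"). A polynomial identity, valid for all real `p, q`.
[cite: Rossman2010, App. B (proof of Lemma 17, p. 14)] -/
theorem sum_sum_gnpWeight_mul_sup (p q : ℝ) (F : ((⊤ : SimpleGraph (Fin n)).edgeSet → Bool) → ℝ) :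
    ∑ x, ∑ y, gnpWeight n p x * gnpWeight n q y * F (x ⊔ y) =
      ∑ z, gnpWeight n (p + q - p * q) z * F z := by
  classical
  -- one-coordinate weights and the pair weights
  set φ : ℝ → Bool → ℝ := fun r b => if b = true then r else 1 - r with hφ
  set Ψ : Bool × Bool → ℝ := fun ab => φ p ab.1 * φ q ab.2 with hΨ
  set orVec : ((⊤ : SimpleGraph (Fin n)).edgeSet → Bool × Bool) →
      ((⊤ : SimpleGraph (Fin n)).edgeSet → Bool) := fun u e => (u e).1 || (u e).2 with horVec
  -- Step 1: pairs of vectors are vectors of pairs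
  have step1 : ∑ x, ∑ y, gnpWeight n p x * gnpWeight n q y * F (x ⊔ y) =
      ∑ u : (⊤ : SimpleGraph (Fin n)).edgeSet → Bool × Bool, (∏ e, Ψ (u e)) * F (orVec u) := by
    rw [← Fintype.sum_prod_type']
    refine (Fintype.sum_equiv (Equiv.arrowProdEquivProdArrow _ _ _) _ _ fun u => ?_).symm
    simp only [Equiv.arrowProdEquivProdArrow_apply]
    rw [gnpWeight_eq_prod, gnpWeight_eq_prod, ← prod_mul_distrib]
    congr 1
  -- Step 2: group by the union vector
  have step2 : ∑ u : (⊤ : SimpleGraph (Fin n)).edgeSet → Bool × Bool, (∏ e, Ψ (u e)) * F (orVec u) =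
      ∑ z, F z * ∑ u ∈ univ.filter (fun u => orVec u = z), ∏ e, Ψ (u e) := by
    rw [← sum_fiberwise univ orVec]
    refine sum_congr rfl fun z _ => ?_
    rw [mul_sum]
    refine sum_congr rfl fun u hu => ?_
    rw [(mem_filter.1 hu).2, mul_comm]
  -- Step 3: the fibre is a product set, so its weight factors
  have step3 : ∀ z : (⊤ : SimpleGraph (Fin n)).edgeSet → Bool,
      ∑ u ∈ univ.filter (fun u => orVec u = z), ∏ e, Ψ (u e) =
        ∏ e, ∑ ab ∈ (univ : Finset (Bool × Bool)).filter (fun ab => (ab.1 || ab.2) = z e), Ψ ab := by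
    intro z
    rw [prod_univ_sum]
    refine sum_congr ?_ fun _ _ => rfl
    ext u
    simp only [mem_filter, mem_univ, true_and, Fintype.mem_piFinset, funext_iff, horVec]
  -- Step 4: the one-edge computation
  have step4 : ∀ z : (⊤ : SimpleGraph (Fin n)).edgeSet → Bool,
      ∏ e, ∑ ab ∈ (univ : Finset (Bool × Bool)).filter (fun ab => (ab.1 || ab.2) = z e), Ψ ab =
        gnpWeight n (p + q - p * q) z := by
    intro z
    rw [gnpWeight_eq_prod]
    refine prod_congr rfl fun e _ => ?_
    exact sum_filter_or_eq_oneEdge p q (z e)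
  rw [step1, step2]
  refine sum_congr rfl fun z _ => ?_
  rw [step3, step4, mul_comm]

/-- Union law for events: `Pr[G₁ ∪ G₂ ∈ S] = Pr[G(n, p+q-pq) ∈ S]` for independent
`G₁ ∼ G(n,p)`, `G₂ ∼ G(n,q)`. [cite: Rossman2010, App. B (proof of Lemma 17, p. 14)] -/
theorem sum_sum_gnpWeight_ite_sup (p q : ℝ)
    (P : ((⊤ : SimpleGraph (Fin n)).edgeSet → Bool) → Prop) [DecidablePred P] :
    ∑ x, ∑ y, gnpWeight n p x * gnpWeight n q y * (if P (x ⊔ y) then 1 else 0) =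
      gnpProb n (p + q - p * q) (univ.filter P) := by
  rw [sum_sum_gnpWeight_mul_sup p q (fun z => if P z then 1 else 0), gnpProb, sum_filter]
  refine sum_congr rfl fun z _ => ?_
  split_ifs <;> simp

/-! ### Planting: independence of disjoint edge sets -/

/-- The product of the one-edge weights over the edges of `t` is `q^{e(t)}`. [folklore] -/
theorem prod_ite_eq_pow_edgeCount (q : ℝ) (t : (⊤ : SimpleGraph (Fin n)).edgeSet → Bool) :
    ∏ e, (if t e = true then q else 1) = q ^ edgeCount t := by
  rw [prod_ite, prod_const, prod_const_one, mul_one, edgeCount]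

open Classical in
/-- **Planting identity** (the edges of a fixed set are independent of the rest): for every edge
vector `t` and every real-valued `G`,
`Σ_{x ⊇ t} w_q(x) G(x) = q^{e(t)} · Σ_x w_q(x) G(x ∨ t)`, i.e.
`E[1_{t ⊆ G} · G(G)] = Pr[t ⊆ G] · E[G(G ∪ t)]` for `G ∼ G(n,q)` (Rossman 2010, App. B, proof of
Lemma 23 (c): "`Pr[K_B ⊈ G | G ∖ K_B = H ∖ K_B] = Pr[K_B ⊈ G]` (by independence)"). A polynomial
identity, valid for all real `q`. [cite: Rossman2010, App. B (proof of Lemma 23, p. 14)] -/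
theorem sum_filter_forall_gnpWeight_mul (q : ℝ) (t : (⊤ : SimpleGraph (Fin n)).edgeSet → Bool)
    (G : ((⊤ : SimpleGraph (Fin n)).edgeSet → Bool) → ℝ) :
    ∑ x ∈ univ.filter (fun x : (⊤ : SimpleGraph (Fin n)).edgeSet → Bool => ∀ e, t e = true → x e = true),
        gnpWeight n q x * G x =
      q ^ edgeCount t * ∑ x, gnpWeight n q x * G (x ⊔ t) := by
  classical
  -- Step 1: group the right-hand side by the planted vector `z = x ∨ t`
  have step1 : ∑ x, gnpWeight n q x * G (x ⊔ t) =
      ∑ z, G z * ∑ x ∈ univ.filter (fun x => x ⊔ t = z), gnpWeight n q x := by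
    rw [← sum_fiberwise univ (fun x => x ⊔ t)]
    refine sum_congr rfl fun z _ => ?_
    rw [mul_sum]
    refine sum_congr rfl fun x hx => ?_
    rw [(mem_filter.1 hx).2, mul_comm]
  -- Step 2: over a vector `z ⊇ t` the fibre is a product set of weight `w(z) / q^{e(t)}`
  have step2 : ∀ z : (⊤ : SimpleGraph (Fin n)).edgeSet → Bool, (∀ e, t e = true → z e = true) →
      q ^ edgeCount t * ∑ x ∈ univ.filter (fun x => x ⊔ t = z), gnpWeight n q x =
        gnpWeight n q z := by
    intro z htz
    have hfib : univ.filter (fun x : (⊤ : SimpleGraph (Fin n)).edgeSet → Bool => x ⊔ t = z) =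
        Fintype.piFinset (fun e => if t e = true then univ else {z e}) := by
      ext x
      simp only [mem_filter, mem_univ, true_and, Fintype.mem_piFinset, funext_iff, sup_apply_bool]
      refine forall_congr' fun e => ?_
      cases hte : t e
      · simp
      · simp [htz e hte]
    rw [hfib]
    simp_rw [gnpWeight_eq_prod]
    rw [← prod_univ_sum (fun e => if t e = true then univ else {z e})
      (fun _ b => if b = true then q else 1 - q)]
    have h1 : ∀ e : (⊤ : SimpleGraph (Fin n)).edgeSet,
        ∑ b ∈ (if t e = true then (univ : Finset Bool) else {z e}), (if b = true then q else 1 - q) =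
          if t e = true then 1 else (if z e = true then q else 1 - q) := by
      intro e
      split_ifs with hte
      · rw [Fintype.sum_bool]; simp
      · rw [sum_singleton]; simp [*]
      · rw [sum_singleton]; simp [*]
    have h2 : ∀ e : (⊤ : SimpleGraph (Fin n)).edgeSet, (if z e = true then q else 1 - q) =
        (if t e = true then q else 1) *
          (if t e = true then 1 else (if z e = true then q else 1 - q)) := by
      intro e
      by_cases hte : t e = true
      · simp [hte, htz e hte]
      · simp [hte]
    rw [prod_congr rfl fun e _ => h1 e, prod_congr rfl fun e _ => h2 e, prod_mul_distrib,
      prod_ite_eq_pow_edgeCount]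
  -- Step 3: over any other `z` the fibre is empty
  have step3 : ∀ z : (⊤ : SimpleGraph (Fin n)).edgeSet → Bool, ¬ (∀ e, t e = true → z e = true) →
      ∑ x ∈ univ.filter (fun x => x ⊔ t = z), gnpWeight n q x = 0 := by
    intro z htz
    refine sum_eq_zero fun x hx => ?_
    exfalso
    refine htz fun e hte => ?_
    rw [← (mem_filter.1 hx).2, sup_apply_bool, hte, Bool.or_true]
  -- assemble
  rw [step1, mul_sum, sum_filter]
  refine sum_congr rfl fun z _ => ?_
  by_cases htz : ∀ e, t e = true → z e = true
  · rw [if_pos htz, mul_left_comm, step2 z htz, mul_comm]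
  · rw [if_neg htz, step3 z htz, mul_zero, mul_zero]

/-- `Pr[K_A ⊆ G(n,q)] = q^{C(|A|,2)}` (the `C(|A|,2)` edges of `K_A` are present independently).
[cite: Rossman2010, App. B (proof of Lemma 23 (c): `Pr[K_B ⊆ G] = p^{C(k,2)}`)] -/
theorem sum_filter_cliqueVec_gnpWeight (q : ℝ) (A : Finset (Fin n)) :
    ∑ x ∈ univ.filter (fun x : (⊤ : SimpleGraph (Fin n)).edgeSet → Bool =>
        ∀ e, cliqueVec A e = true → x e = true), gnpWeight n q x = q ^ (#A).choose 2 := by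
  classical
  have h := sum_filter_forall_gnpWeight_mul q (cliqueVec A) (fun _ => (1 : ℝ))
  simp only [mul_one] at h
  rw [h, sum_gnpWeight, mul_one, ← card_filter_cliqueVec A, edgeCount]

/-! ### Sprinkling: the first-moment bound for new cliques -/

/-- **Sprinkling bound** (first moment). For independent `G₁ ∼ G(n,p)`, `G₂ ∼ G(n,q)`,
`p, q ∈ [0,1]`: `Pr[ω_k(G₁ ∪ G₂) ≥ 1 ∧ ω_k(G₁) = 0] ≤ C(n,k) ((p+q-pq)^{C(k,2)} - p^{C(k,2)})`,
since a `k`-clique of the union which is not a clique of `G₁` is, for some `k`-set `A`, the event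
`K_A ⊆ G₁ ∪ G₂ ∖ K_A ⊆ G₁` of probability `(p+q-pq)^{C(k,2)} - p^{C(k,2)}`. This elementary
estimate stands in for "`Pr[ω_k(G^θ) = 0] ∼ Pr[ω_k(G^θ ∪ G⁻) = 0]` … by the well-known
asymptotics of `E[ω_k(G(n,p))]`" in Rossman's proof of Lemma 17.
[cite: Rossman2010, App. B (proof of Lemma 17, p. 14)] -/
theorem sum_sum_gnpWeight_newClique_le {p q : ℝ} (hp0 : 0 ≤ p) (hp1 : p ≤ 1) (hq0 : 0 ≤ q)
    (hq1 : q ≤ 1) (k : ℕ) :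
    ∑ x, ∑ y, gnpWeight n p x * gnpWeight n q y *
        (if cliqueCount n k (x ⊔ y) ≠ 0 ∧ cliqueCount n k x = 0 then (1 : ℝ) else 0) ≤
      (n.choose k : ℝ) * ((p + q - p * q) ^ k.choose 2 - p ^ k.choose 2) := by
  classical
  -- indicator of `K_A ⊆ z`
  set ind : Finset (Fin n) → ((⊤ : SimpleGraph (Fin n)).edgeSet → Bool) → ℝ :=
    fun A z => if ∀ e, cliqueVec A e = true → z e = true then 1 else 0 with hind
  have hterm : ∀ (A : Finset (Fin n)) (x y : (⊤ : SimpleGraph (Fin n)).edgeSet → Bool),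
      0 ≤ ind A (x ⊔ y) - ind A x := by
    intro A x y
    simp only [hind]
    by_cases h : ∀ e, cliqueVec A e = true → x e = true
    · rw [if_pos h, if_pos (forall_cliqueVec_sup_of_left A x y h)]
      norm_num
    · rw [if_neg h]
      split_ifs <;> norm_num
  -- pointwise bound by the number of new cliques
  have hpt : ∀ x y : (⊤ : SimpleGraph (Fin n)).edgeSet → Bool,
      (if cliqueCount n k (x ⊔ y) ≠ 0 ∧ cliqueCount n k x = 0 then (1 : ℝ) else 0) ≤
        ∑ A ∈ powersetCard k (univ : Finset (Fin n)), (ind A (x ⊔ y) - ind A x) := by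
    intro x y
    split_ifs with hc
    · obtain ⟨hne, h0⟩ := hc
      obtain ⟨A, hA, hsub⟩ : ∃ A ∈ powersetCard k (univ : Finset (Fin n)),
          ∀ e, cliqueVec A e = true → (x ⊔ y) e = true := by
        by_contra hcon
        exact hne ((cliqueCount_eq_zero_iff_forall _).2 fun A hA hsub => hcon ⟨A, hA, hsub⟩)
      have hnot : ¬ ∀ e, cliqueVec A e = true → x e = true :=
        (cliqueCount_eq_zero_iff_forall x).1 h0 A hA
      calc (1 : ℝ) = ind A (x ⊔ y) - ind A x := by
            simp only [hind]
            rw [if_pos hsub, if_neg hnot]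
            norm_num
        _ ≤ ∑ A ∈ powersetCard k (univ : Finset (Fin n)), (ind A (x ⊔ y) - ind A x) :=
          single_le_sum (fun A _ => hterm A x y) hA
    · exact sum_nonneg fun A _ => hterm A x y
  -- the two expectations of the indicator
  have hunion : ∀ A ∈ powersetCard k (univ : Finset (Fin n)),
      ∑ x, ∑ y, gnpWeight n p x * gnpWeight n q y * ind A (x ⊔ y) = (p + q - p * q) ^ k.choose 2 := by
    intro A hA
    simp only [hind]
    rw [sum_sum_gnpWeight_ite_sup p q (fun z => ∀ e, cliqueVec A e = true → z e = true), gnpProb,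
      sum_filter_cliqueVec_gnpWeight, (mem_powersetCard.1 hA).2]
  have hplain : ∀ A ∈ powersetCard k (univ : Finset (Fin n)),
      ∑ x, ∑ y, gnpWeight n p x * gnpWeight n q y * ind A x = p ^ k.choose 2 := by
    intro A hA
    have h1 : ∀ x : (⊤ : SimpleGraph (Fin n)).edgeSet → Bool,
        ∑ y, gnpWeight n p x * gnpWeight n q y * ind A x = gnpWeight n p x * ind A x := by
      intro x
      have : ∀ y : (⊤ : SimpleGraph (Fin n)).edgeSet → Bool,
          gnpWeight n p x * gnpWeight n q y * ind A x = gnpWeight n p x * ind A x * gnpWeight n q y :=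
        fun y => by ring
      rw [sum_congr rfl fun y _ => this y, ← mul_sum, sum_gnpWeight, mul_one]
    rw [sum_congr rfl fun x _ => h1 x]
    simp only [hind, mul_ite, mul_one, mul_zero]
    rw [← sum_filter, sum_filter_cliqueVec_gnpWeight, (mem_powersetCard.1 hA).2]
  -- sum up
  calc ∑ x, ∑ y, gnpWeight n p x * gnpWeight n q y *
          (if cliqueCount n k (x ⊔ y) ≠ 0 ∧ cliqueCount n k x = 0 then (1 : ℝ) else 0)
      ≤ ∑ x, ∑ y, gnpWeight n p x * gnpWeight n q y *
          ∑ A ∈ powersetCard k (univ : Finset (Fin n)), (ind A (x ⊔ y) - ind A x) :=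
        sum_le_sum fun x _ => sum_le_sum fun y _ => mul_le_mul_of_nonneg_left (hpt x y)
          (mul_nonneg (gnpWeight_nonneg hp0 hp1 x) (gnpWeight_nonneg hq0 hq1 y))
    _ = ∑ A ∈ powersetCard k (univ : Finset (Fin n)),
          (∑ x, ∑ y, gnpWeight n p x * gnpWeight n q y * ind A (x ⊔ y) -
            ∑ x, ∑ y, gnpWeight n p x * gnpWeight n q y * ind A x) := by
        simp_rw [mul_sum, mul_sub, ← sum_sub_distrib]
        exact (sum_congr rfl fun x _ => Finset.sum_comm).trans Finset.sum_comm
    _ = ∑ A ∈ powersetCard k (univ : Finset (Fin n)), ((p + q - p * q) ^ k.choose 2 - p ^ k.choose 2) :=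
        sum_congr rfl fun A hA => by rw [hunion A hA, hplain A hA]
    _ = (n.choose k : ℝ) * ((p + q - p * q) ^ k.choose 2 - p ^ k.choose 2) := by
        rw [sum_const, card_powersetCard, card_univ, Fintype.card_fin, nsmul_eq_mul]

/-! ### Consequences for a monotone test -/

/-- **Sprinkling onto a clique-free graph.** For `G₁ ∼ G(n,p)`, `G₂ ∼ G(n,q)` independent
(`p, q ∈ [0,1]`) and any Boolean `f`,
`Pr[f(G₁ ∪ G₂) = 1 ∧ ω_k(G₁) = 0] ≤ Pr[f(G) = 1 ∧ ω_k(G) = 0] + C(n,k)((p+q-pq)^{C(k,2)} - p^{C(k,2)})`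
with `G ∼ G(n, p+q-pq)` (union law plus the sprinkling bound); the left-hand side is written as
`Σ_{x : ω_k(x)=0} w_p(x) · Pr_{y ∼ G(n,q)}[f(x ∨ y) = 1]`.
[cite: Rossman2010, App. B (proof of Lemma 17, p. 14)] -/
theorem sum_cliqueFree_gnpWeight_mul_gnpProb_sup_le {p q : ℝ} (hp0 : 0 ≤ p) (hp1 : p ≤ 1)
    (hq0 : 0 ≤ q) (hq1 : q ≤ 1) (k : ℕ)
    (f : ((⊤ : SimpleGraph (Fin n)).edgeSet → Bool) → Bool) :
    ∑ x ∈ univ.filter (fun x : (⊤ : SimpleGraph (Fin n)).edgeSet → Bool => cliqueCount n k x = 0),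
        gnpWeight n p x * gnpProb n q (univ.filter fun y => f (x ⊔ y) = true) ≤
      gnpProb n (p + q - p * q) (univ.filter fun z => f z = true ∧ cliqueCount n k z = 0) +
        (n.choose k : ℝ) * ((p + q - p * q) ^ k.choose 2 - p ^ k.choose 2) := by
  classical
  -- the left-hand side as a double sum of indicators
  have hL : ∑ x ∈ univ.filter (fun x : (⊤ : SimpleGraph (Fin n)).edgeSet → Bool => cliqueCount n k x = 0),
        gnpWeight n p x * gnpProb n q (univ.filter fun y => f (x ⊔ y) = true) =
      ∑ x, ∑ y, gnpWeight n p x * gnpWeight n q y *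
        (if f (x ⊔ y) = true ∧ cliqueCount n k x = 0 then (1 : ℝ) else 0) := by
    rw [sum_filter]
    refine sum_congr rfl fun x _ => ?_
    by_cases hx : cliqueCount n k x = 0
    · rw [if_pos hx, gnpProb, sum_filter, mul_sum]
      refine sum_congr rfl fun y _ => ?_
      by_cases hy : f (x ⊔ y) = true
      · simp [hx, hy]
      · simp [hy]
    · rw [if_neg hx]
      symm
      refine sum_eq_zero fun y _ => ?_
      simp [hx]
  -- pointwise splitting according to `ω_k(x ∨ y)`
  have hpt : ∀ x y : (⊤ : SimpleGraph (Fin n)).edgeSet → Bool,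
      (if f (x ⊔ y) = true ∧ cliqueCount n k x = 0 then (1 : ℝ) else 0) ≤
        (if f (x ⊔ y) = true ∧ cliqueCount n k (x ⊔ y) = 0 then (1 : ℝ) else 0) +
          (if cliqueCount n k (x ⊔ y) ≠ 0 ∧ cliqueCount n k x = 0 then (1 : ℝ) else 0) := by
    intro x y
    by_cases h1 : f (x ⊔ y) = true <;> by_cases h2 : cliqueCount n k x = 0 <;>
      by_cases h3 : cliqueCount n k (x ⊔ y) = 0 <;> simp [h1, h2, h3]
  rw [hL]
  calc ∑ x, ∑ y, gnpWeight n p x * gnpWeight n q y *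
          (if f (x ⊔ y) = true ∧ cliqueCount n k x = 0 then (1 : ℝ) else 0)
      ≤ ∑ x, ∑ y, gnpWeight n p x * gnpWeight n q y *
          ((if f (x ⊔ y) = true ∧ cliqueCount n k (x ⊔ y) = 0 then (1 : ℝ) else 0) +
            (if cliqueCount n k (x ⊔ y) ≠ 0 ∧ cliqueCount n k x = 0 then (1 : ℝ) else 0)) :=
        sum_le_sum fun x _ => sum_le_sum fun y _ => mul_le_mul_of_nonneg_left (hpt x y)
          (mul_nonneg (gnpWeight_nonneg hp0 hp1 x) (gnpWeight_nonneg hq0 hq1 y))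
    _ = ∑ x, ∑ y, gnpWeight n p x * gnpWeight n q y *
          (if f (x ⊔ y) = true ∧ cliqueCount n k (x ⊔ y) = 0 then (1 : ℝ) else 0) +
        ∑ x, ∑ y, gnpWeight n p x * gnpWeight n q y *
          (if cliqueCount n k (x ⊔ y) ≠ 0 ∧ cliqueCount n k x = 0 then (1 : ℝ) else 0) := by
        simp_rw [mul_add, sum_add_distrib]
    _ ≤ _ := by
        rw [sum_sum_gnpWeight_ite_sup p q (fun z => f z = true ∧ cliqueCount n k z = 0)]
        exact add_le_add le_rfl (sum_sum_gnpWeight_newClique_le hp0 hp1 hq0 hq1 k)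

/-- For a MONOTONE test `f` the false-positive event `{f = 1 ∧ ω_k = 0}` of `G(n,p)` is controlled
by sprinkling: `Pr_p[f = 1 ∧ ω_k = 0] ≤ Σ_{x : ω_k(x)=0} w_p(x) Pr_{y ∼ G(n,q)}[f(x ∨ y) = 1]`
(`f(x) = 1` forces `f(x ∨ y) = 1`). [folklore] -/
theorem gnpProb_pos_cliqueFree_le_sprinkle {p q : ℝ} (hp0 : 0 ≤ p) (hp1 : p ≤ 1)
    (hq0 : 0 ≤ q) (hq1 : q ≤ 1) (k : ℕ)
    {f : ((⊤ : SimpleGraph (Fin n)).edgeSet → Bool) → Bool} (hf : Monotone f) :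
    gnpProb n p (univ.filter fun x => f x = true ∧ cliqueCount n k x = 0) ≤
      ∑ x ∈ univ.filter (fun x : (⊤ : SimpleGraph (Fin n)).edgeSet → Bool => cliqueCount n k x = 0),
        gnpWeight n p x * gnpProb n q (univ.filter fun y => f (x ⊔ y) = true) := by
  classical
  rw [gnpProb, sum_filter, sum_filter]
  refine sum_le_sum fun x _ => ?_
  by_cases hx : cliqueCount n k x = 0
  · rw [if_pos hx]
    by_cases hfx : f x = true
    · have hall : (univ.filter fun y : (⊤ : SimpleGraph (Fin n)).edgeSet → Bool => f (x ⊔ y) = true) =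
          univ := by
        refine filter_true_of_mem fun y _ => ?_
        have h1 : true ≤ f (x ⊔ y) := hfx ▸ hf (le_sup_left : x ≤ x ⊔ y)
        revert h1
        cases f (x ⊔ y) <;> decide
      rw [if_pos ⟨hfx, hx⟩, hall, gnpProb_univ, mul_one]
    · rw [if_neg (fun h => hfx h.1)]
      exact mul_nonneg (gnpWeight_nonneg hp0 hp1 x) (gnpProb_nonneg hq0 hq1 _)
  · rw [if_neg (fun h => hx h.2), if_neg hx]

/-- **Raising the density.** For a monotone test `f` and `0 ≤ p ≤ p' ≤ 1`:
`Pr_{p}[f = 1 ∧ ω_k = 0] ≤ Pr_{p'}[f = 1 ∧ ω_k = 0] + C(n,k)(p'^{C(k,2)} - p^{C(k,2)})`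
(couple `G(n,p') = G(n,p) ∪ G(n,q)` with `q = (p'-p)/(1-p)`: on the event that no new `k`-clique
appears the false positive persists). [cite: Rossman2010, App. B (proof of Lemma 17, p. 14)] -/
theorem gnpProb_pos_cliqueFree_mono {p p' : ℝ} (hp0 : 0 ≤ p) (hpp' : p ≤ p') (hp'1 : p' ≤ 1)
    (k : ℕ) {f : ((⊤ : SimpleGraph (Fin n)).edgeSet → Bool) → Bool} (hf : Monotone f) :
    gnpProb n p (univ.filter fun x => f x = true ∧ cliqueCount n k x = 0) ≤
      gnpProb n p' (univ.filter fun x => f x = true ∧ cliqueCount n k x = 0) +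
        (n.choose k : ℝ) * (p' ^ k.choose 2 - p ^ k.choose 2) := by
  rcases eq_or_lt_of_le (hpp'.trans hp'1) with hp1 | hp1
  · -- `p = p' = 1`
    have hp' : p' = 1 := le_antisymm hp'1 (hp1 ▸ hpp')
    subst hp1; subst hp'
    simp
  · set q : ℝ := (p' - p) / (1 - p) with hq
    have h1p : 0 < 1 - p := sub_pos.2 hp1
    have hq0 : 0 ≤ q := div_nonneg (sub_nonneg.2 hpp') h1p.le
    have hq1 : q ≤ 1 := (div_le_one h1p).2 (by linarith)
    have hpq : p + q - p * q = p' := by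
      rw [hq]; field_simp; ring
    have h := (gnpProb_pos_cliqueFree_le_sprinkle hp0 hp1.le hq0 hq1 k hf).trans
      (sum_cliqueFree_gnpWeight_mul_gnpProb_sup_le hp0 hp1.le hq0 hq1 k f)
    rwa [hpq] at h

end Literature.Computability.Complexity

end
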